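import Summits.HodgeConjecture.CorCM.SimpleCMSurfaceTimesCMHodge
import Summits.HodgeConjecture.CorCM.DihedralReflexSwapReflect
import Summits.HodgeConjecture.CorCM.ImaginaryQuadraticsTimesConjSquareCMHodge
import Literature.AlgebraicGeometry.Pohlmann1968.CMTypeRankLowerBoundsNumberField
import HarnessLib

/-!
# A simple CM abelian SURFACE times a CM abelian THREEFOLD is always a nondegenerate pair: the Galois closure of a
# sextic CM field contains no cyclic or dihedral quartic CM field

COR-CM (cell `pub-hodgecm2`, binder seat `b16` gen 38, count-neutral claim SURF-T3; theorems only, no definition, no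
named fact).  NEW as stated, hence under `Summits/`.

[MoonenZarhin1999LowDim, Thm. (0.2) (4)] (dimension `5`, «not in one of the cases (e), (f), (g)»: `Hg(X) = ∏ Hg(Y_j^{m_j})`
and `B•(Xⁿ) = D•(Xⁿ)` when no simple factor has dimension `4`) contains the case `X ∼ S × T`, `S` a simple CM abelian
surface and `T` a simple CM abelian threefold: the pair is NONDEGENERATE whatever the fields.  Seat b23's
`CorCM/SimpleCMSurfaceTimesCMHodge` proves this GIVEN `L_S ⊄ L_T` for the Galois closures in `ℂ` (then `L_S ∩ L_T` is a
proper normal subfield of `L_S`, hence totally real, and partial conjugations exist), and discharges the hypothesis when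
`[L_T : ℚ]` is not a multiple of `[L_S : ℚ]` — e.g. a Galois sextic `K_T`.  This file removes the hypothesis for EVERY
sextic CM field `K_T` (`[L_T : ℚ] ∈ {6, 12, 24, 48}`):

* §1 **`not_normalClosure_le_of_smul_smul_eq_conjugate_of_finrank_eq_six`** — if `K` is a CM field admitting
  `τ ∈ Aut(ℂ)` with `τ² =` complex conjugation on `Hom(K, ℂ)` (every quartic CM field with a primitive CM type: cyclic
  or non-Galois, seat p2) and `M` is ANY CM field of degree `6`, then `normalClosure ℚ K ℂ ⊄ normalClosure ℚ M ℂ`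
  (proof on embeddings, `Gal(L_M/ℚ) ⊆ C₂ ≀ S₃`: see the theorem); corollary `not_normalClosure_le_of_quartic_of_sextic`
  (quartic CM `K`, not biquadratic);
* §2 BY NAME through seat b23's SURFX: **`isNondegenerateFamily_surface_threefold_iff`** (`K_{i₀}` quartic CM not
  biquadratic, `K_{i₁}` ANY sextic CM field: nondegenerate iff `Φ_{i₁}` is), `…_of_isPrimitive` (Ribet);
  **`hodgeConjectureFor_prod_simpleSurface_simpleThreefold`** — for EVERY simple CM abelian surface `S` and EVERY simple
  CM abelian threefold `T`: the Hodge conjecture and `B• = D•` on every `S^a × T^b`, UNCONDITIONALLY — the partition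
  `{3, 2}` of Moonen–Zarhin (0.2) (4), CM case; `not_exists_exceptional_prod_simpleSurface_simpleThreefold`.

## References

* [MoonenZarhin1999LowDim] B. Moonen, Yu. Zarhin, *Hodge classes on abelian varieties of low dimension*, Math. Ann.
  315 (1999) 711–733, Thm. (0.2) (4), §3 Cor. (3.9), §5.
* [Dodson1984] B. Dodson, *The structure of Galois groups of CM-fields*, Trans. AMS 283 (1984), §1 (imprimitivity:
  `Gal(L/ℚ) ⊆ C₂ ≀ S_n`).
* [Shimura1998] G. Shimura, *Abelian Varieties with Complex Multiplication and Modular Functions*, §8.4 Example (2).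
* [Gordon1999HodgeAVSurvey] B. B. Gordon, *A survey of the Hodge conjecture for abelian varieties*, §3 Theorem, 7.5, 10.10.
-/

noncomputable section

open CategoryTheory CategoryTheory.Limits NumberField NumberField.ComplexEmbedding IntermediateField Module

namespace Summit.HodgeConjecture.CorCM

open Literature.NumberTheory.ComplexMultiplication
open Literature.AlgebraicGeometry.Motives (AbelianVariety CMType)
open Literature.AlgebraicGeometry.HodgeTheory
open Literature.AlgebraicGeometry.ComplexMultiplication (IsCMTypeRealisation isSimple_iff_isPrimitive)
open Literature.AlgebraicGeometry.VanGeemen1994 (hodgeClassSpan)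
open Literature.AlgebraicGeometry.Pohlmann1968
open Literature.Barriers.HodgeConjecture (divisorClassesSpan)
open QuarticCM (conjugate_ne smul_conjugate)

/-! ## §1 The Galois closure of a sextic CM field contains no cyclic or dihedral quartic CM field -/

section Fields

variable {K M : Type} [Field K] [NumberField K] [IsCMField K] [Field M] [NumberField M] [IsCMField M]

/-- The six embeddings `a, ā, b, b̄, c, c̄` of a sextic CM field are pairwise distinct and exhaust `Hom(M, ℂ)`.
[folklore] -/
private theorem eq_or_of_six (h6 : finrank ℚ M = 6) {a b c : M →+* ℂ} (hba : b ≠ a) (hba' : b ≠ conjugate a)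
    (hca : c ≠ a) (hca' : c ≠ conjugate a) (hcb : c ≠ b) (hcb' : c ≠ conjugate b) (x : M →+* ℂ) :
    x = a ∨ x = conjugate a ∨ x = b ∨ x = conjugate b ∨ x = c ∨ x = conjugate c := by
  classical
  have hinv := involutive_conjugate M
  have hab' : conjugate b ≠ a := fun h => hba' (by rw [← h, hinv b])
  have hbb : conjugate b ≠ conjugate a := fun h => hba (hinv.injective h)
  have hac' : conjugate c ≠ a := fun h => hca' (by rw [← h, hinv c])
  have hcc : conjugate c ≠ conjugate a := fun h => hca (hinv.injective h)
  have hbc' : conjugate c ≠ b := fun h => hcb' (by rw [← h, hinv c])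
  have hccb : conjugate c ≠ conjugate b := fun h => hcb (hinv.injective h)
  have hcard : ({a, conjugate a, b, conjugate b, c, conjugate c} : Finset (M →+* ℂ)).card = 6 := by
    rw [Finset.card_insert_of_notMem (by simp [(conjugate_ne a).symm, hba.symm, hab'.symm, hca.symm, hac'.symm]),
      Finset.card_insert_of_notMem (by simp [hba'.symm, hbb.symm, hca'.symm, hcc.symm]),
      Finset.card_insert_of_notMem (by simp [(conjugate_ne b).symm, hcb.symm, hbc'.symm]),
      Finset.card_insert_of_notMem (by simp [hcb'.symm, hccb.symm]), Finset.card_pair (conjugate_ne c).symm]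
  have huniv := Finset.eq_univ_of_card _ (by rw [hcard, Embeddings.card, h6])
  have hx : x ∈ ({a, conjugate a, b, conjugate b, c, conjugate c} : Finset (M →+* ℂ)) := huniv ▸ Finset.mem_univ x
  simpa using hx

/-- **The Galois closure of a sextic CM field contains no quartic CM field with a square root of conjugation.**  Let
`K` be a CM field admitting `τ ∈ Aut(ℂ)` with `τ ∘ τ ∘ s = s̄` for every `s : K → ℂ` (a cyclic or a non-Galois quartic
CM field), and `M` a CM field of degree `6`.  Then `normalClosure ℚ K ℂ ⊄ normalClosure ℚ M ℂ`.  (The Galois group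
of the closure of `M` lies in `C₂ ≀ S₃`; `τ` permutes the three conjugate pairs of `Hom(M, ℂ)`: all pairs fixed ⟹ `τ²`
trivial on `L_M`; no pair fixed ⟹ `τ⁶` trivial on `L_M` but `= τ²` on `Hom(K, ℂ)`; one pair fixed ⟹ `τ² ∘ conj` is a
one-pair conjugation of `Hom(M, ℂ)` trivial on `Hom(K, ℂ)`, and three conjugates of it compose to `conj`.)
[cite: Dodson1984, §1] [cite: MoonenZarhin1999LowDim, Thm. (0.2) (4) and §5] -/
theorem not_normalClosure_le_of_smul_smul_eq_conjugate_of_finrank_eq_six (h6 : finrank ℚ M = 6) {τ : ℂ ≃+* ℂ}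
    (hτ : ∀ s : K →+* ℂ, τ • τ • s = conjugate s) : ¬ normalClosure ℚ K ℂ ≤ normalClosure ℚ M ℂ := by
  intro hle
  classical
  obtain ⟨s₀⟩ : Nonempty (K →+* ℂ) := inferInstance
  have hKM : ∀ (s : K →+* ℂ) (y : K), s y ∈ normalClosure ℚ M ℂ := fun s y =>
    hle (AlgHom.fieldRange_le_normalClosure s.toRatAlgHom ⟨y, rfl⟩)
  have htr : ∀ {γ γ' : ℂ ≃+* ℂ}, (∀ t : M →+* ℂ, γ • t = γ' • t) → ∀ s : K →+* ℂ, γ • s = γ' • s :=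
    fun h s => DihedralReflexPair.smul_eq_smul_of_forall_smul_eq hKM h s
  have hinvM : ∀ t : M →+* ℂ, conjugate (conjugate t) = t := involutive_conjugate M
  have hinvK : ∀ s : K →+* ℂ, conjugate (conjugate s) = s := involutive_conjugate K
  have hK4 : ∀ s : K →+* ℂ, τ • τ • τ • τ • s = s := fun s => by rw [hτ s, hτ (conjugate s), hinvK]
  have L1 : ∀ t : M →+* ℂ, (τ • t = t ∨ τ • t = conjugate t) → τ • τ • t = t := by
    rintro t (h | h)
    · rw [h, h]
    · rw [h, smul_conjugate, h, hinvM]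
  have L1c : ∀ t : M →+* ℂ, (τ • t = t ∨ τ • t = conjugate t) →
      (τ • conjugate t = conjugate t ∨ τ • conjugate t = conjugate (conjugate t)) := by
    rintro t (h | h) <;> [exact Or.inl (by rw [smul_conjugate, h]); exact Or.inr (by rw [smul_conjugate, h])]
  have L2 : ∀ t₀ y : M →+* ℂ, (τ • t₀ = t₀ ∨ τ • t₀ = conjugate t₀) →
      (τ • y = t₀ ∨ τ • y = conjugate t₀) → (y = t₀ ∨ y = conjugate t₀) := by
    rintro t₀ y (h | h) (hy | hy)
    · exact Or.inl ((smul_left_cancel_iff τ).1 (hy.trans h.symm))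
    · exact Or.inr ((smul_left_cancel_iff τ).1 (hy.trans (by rw [smul_conjugate, h])))
    · exact Or.inr ((smul_left_cancel_iff τ).1 (hy.trans (by rw [smul_conjugate, h, hinvM])))
    · exact Or.inl ((smul_left_cancel_iff τ).1 (hy.trans h.symm))
  by_cases hA : ∀ t : M →+* ℂ, τ • t = t ∨ τ • t = conjugate t
  · -- case A: every pair is `τ`-stable, so `τ²` fixes `Hom(M, ℂ)` pointwise
    have := htr (fun t => show (τ * τ) • t = (1 : ℂ ≃+* ℂ) • t by rw [mul_smul, one_smul]; exact L1 t (hA t)) s₀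
    rw [mul_smul, one_smul, hτ] at this
    exact conjugate_ne s₀ this
  push Not at hA
  obtain ⟨t₁, ht₁, ht₁'⟩ := hA
  by_cases hC : ∃ t₀ : M →+* ℂ, τ • t₀ = t₀ ∨ τ • t₀ = conjugate t₀
  · -- case C: exactly one stable pair `{t₀, t̄₀}`; the other two pairs `{t₁, t̄₁}`, `{t₂, t̄₂}` are swapped by `τ`
    obtain ⟨t₀, ht₀⟩ := hC
    have h10 : t₁ ≠ t₀ := fun h => by rw [h] at ht₁ ht₁'; rcases ht₀ with h' | h' <;> [exact ht₁ h'; exact ht₁' h']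
    have h10' : t₁ ≠ conjugate t₀ := fun h => by
      rw [h] at ht₁ ht₁'
      rcases L1c t₀ ht₀ with h' | h' <;> [exact ht₁ h'; exact ht₁' h']
    set t₂ := τ • t₁ with ht₂def
    have h21 : t₂ ≠ t₁ := ht₁
    have h21' : t₂ ≠ conjugate t₁ := ht₁'
    have h20 : t₂ ≠ t₀ := fun h => by
      rcases L2 t₀ t₁ ht₀ (Or.inl h) with h' | h' <;> [exact h10 h'; exact h10' h']
    have h20' : t₂ ≠ conjugate t₀ := fun h => by
      rcases L2 t₀ t₁ ht₀ (Or.inr h) with h' | h' <;> [exact h10 h'; exact h10' h']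
    have hsix := eq_or_of_six h6 h10 h10' h20 h20' h21 h21'
    -- `t₂` is not stable (else `τ` would map the pair of `t₁` to itself)
    have ht₂ns : ¬ (τ • t₂ = t₂ ∨ τ • t₂ = conjugate t₂) := fun h => by
      rcases L2 t₂ t₁ h (Or.inl rfl) with h' | h'
      · exact h21 h'.symm
      · exact h21' (by rw [h', hinvM])
    -- hence `τ • t₂ ∈ {t₁, t̄₁}`
    have hτt₂ : τ • t₂ = t₁ ∨ τ • t₂ = conjugate t₁ := by
      rcases hsix (τ • t₂) with h | h | h | h | h | h
      · rcases L2 t₀ t₂ ht₀ (Or.inl h) with h' | h' <;> [exact (h20 h').elim; exact (h20' h').elim]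
      · rcases L2 t₀ t₂ ht₀ (Or.inr h) with h' | h' <;> [exact (h20 h').elim; exact (h20' h').elim]
      · exact Or.inl h
      · exact Or.inr h
      · exact (ht₂ns (Or.inl h)).elim
      · exact (ht₂ns (Or.inr h)).elim
    -- `n = τ²` fixes `t₀, t̄₀`, commutes with `τ`, and is non-trivial on `Hom(M, ℂ)`: it swaps both other pairs
    have hn0 : τ • τ • t₀ = t₀ := L1 t₀ ht₀
    have hn0' : τ • τ • conjugate t₀ = conjugate t₀ := by rw [smul_conjugate, smul_conjugate, hn0]
    have hn1 : τ • τ • t₁ = conjugate t₁ := by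
      rcases hτt₂ with h | h
      · -- `n` fixes `t₁`, hence everything: contradiction on `Hom(K, ℂ)`
        exfalso
        have hfix : ∀ t : M →+* ℂ, (τ * τ) • t = (1 : ℂ ≃+* ℂ) • t := by
          intro t
          rw [mul_smul, one_smul]
          rcases hsix t with rfl | rfl | rfl | rfl | rfl | rfl
          · exact hn0
          · exact hn0'
          · exact h
          · rw [smul_conjugate, smul_conjugate, h]
          · change τ • τ • τ • t₁ = τ • t₁
            rw [h]
          · change τ • τ • conjugate (τ • t₁) = conjugate (τ • t₁)
            rw [smul_conjugate, smul_conjugate, h]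
        have := htr hfix s₀
        rw [mul_smul, one_smul, hτ] at this
        exact conjugate_ne s₀ this
      · exact h
    have hn1' : τ • τ • conjugate t₁ = t₁ := by rw [smul_conjugate, smul_conjugate, hn1, hinvM]
    have hn2 : τ • τ • t₂ = conjugate t₂ := by
      change τ • τ • τ • t₁ = conjugate (τ • t₁)
      rw [hn1, smul_conjugate]
    have hn2' : τ • τ • conjugate t₂ = t₂ := by rw [smul_conjugate, smul_conjugate, hn2, hinvM]
    -- `m = τ² ∘ conj`: trivial on `Hom(K, ℂ)`, conjugates the pair of `t₀`, fixes the four other embeddings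
    set m : ℂ ≃+* ℂ := τ * τ * starRingAut with hmdef
    have hmK : ∀ s : K →+* ℂ, m • s = s := fun s => by
      rw [hmdef, mul_smul, mul_smul, conj_smul_eq_conjugate, smul_conjugate, smul_conjugate, hτ, hinvK]
    have hm0 : m • t₀ = conjugate t₀ := by rw [hmdef, mul_smul, mul_smul, conj_smul_eq_conjugate, hn0']
    have hm0' : m • conjugate t₀ = t₀ := by rw [hmdef, mul_smul, mul_smul, conj_smul_eq_conjugate, hinvM, hn0]
    have hmfix : ∀ x : M →+* ℂ, x ≠ t₀ → x ≠ conjugate t₀ → m • x = x := by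
      intro x hx hx'
      rw [hmdef, mul_smul, mul_smul, conj_smul_eq_conjugate]
      rcases hsix x with rfl | rfl | rfl | rfl | rfl | rfl
      · exact (hx rfl).elim
      · exact (hx' rfl).elim
      · exact hn1'
      · rw [hinvM]; exact hn1
      · exact hn2'
      · rw [hinvM]; exact hn2
    -- conjugating `m` moves the flipped pair anywhere
    have hconj : ∀ h : ℂ ≃+* ℂ, (∀ s : K →+* ℂ, (h * m * h⁻¹) • s = s) ∧
        (h * m * h⁻¹) • (h • t₀) = conjugate (h • t₀) ∧ (h * m * h⁻¹) • conjugate (h • t₀) = h • t₀ ∧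
        ∀ x : M →+* ℂ, x ≠ h • t₀ → x ≠ conjugate (h • t₀) → (h * m * h⁻¹) • x = x := by
      intro h
      refine ⟨fun s => ?_, ?_, ?_, fun x hx hx' => ?_⟩
      · rw [mul_smul, mul_smul, hmK, smul_inv_smul]
      · rw [mul_smul, mul_smul, inv_smul_smul, hm0, smul_conjugate]
      · rw [mul_smul, mul_smul, ← smul_conjugate, inv_smul_smul, hm0']
      · rw [mul_smul, mul_smul]
        have h1 : h⁻¹ • x ≠ t₀ := fun e => hx (by rw [← e, smul_inv_smul])
        have h2 : h⁻¹ • x ≠ conjugate t₀ := fun e => hx' (by rw [← smul_conjugate, ← e, smul_inv_smul])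
        rw [hmfix _ h1 h2, smul_inv_smul]
    -- flips at the pairs of `t₁` and `t₂`
    haveI := isPretransitive_ringEquiv_complex (K := M)
    obtain ⟨g₁, hg₁⟩ := MulAction.exists_smul_eq (ℂ ≃+* ℂ) t₀ t₁
    obtain ⟨g₂, hg₂⟩ := MulAction.exists_smul_eq (ℂ ≃+* ℂ) t₀ t₂
    obtain ⟨hm₁K, hm₁a, hm₁b, hm₁c⟩ := hconj g₁
    obtain ⟨hm₂K, hm₂a, hm₂b, hm₂c⟩ := hconj g₂
    rw [hg₁] at hm₁a hm₁b hm₁c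
    rw [hg₂] at hm₂a hm₂b hm₂c
    -- the composite `m ∘ m₁ ∘ m₂ ∘ conj` fixes every embedding of `M` …
    have hcc : ∀ {x y : M →+* ℂ}, x ≠ y → conjugate x ≠ conjugate y := fun h e =>
      h ((involutive_conjugate M).injective e)
    have hsw : ∀ {x y : M →+* ℂ}, x ≠ conjugate y → conjugate x ≠ y := fun h e => h (by rw [← e, hinvM])
    have hsw' : ∀ {x y : M →+* ℂ}, x ≠ conjugate y → y ≠ conjugate x := fun h e => h (by rw [e, hinvM])
    have hall : ∀ t : M →+* ℂ, (m * (g₁ * m * g₁⁻¹) * (g₂ * m * g₂⁻¹) * starRingAut) • t = (1 : ℂ ≃+* ℂ) • t := by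
      intro t
      rw [mul_smul, mul_smul, mul_smul, one_smul, conj_smul_eq_conjugate]
      rcases hsix t with rfl | rfl | rfl | rfl | rfl | rfl
      · -- `t₀ ↦ t̄₀ ↦ t̄₀ ↦ t̄₀ ↦ t₀`
        rw [hm₂c _ h20'.symm (hcc h20.symm), hm₁c _ h10'.symm (hcc h10.symm), hm0']
      · rw [hinvM, hm₂c _ h20.symm (hsw' h20'), hm₁c _ h10.symm (hsw' h10'), hm0]
      · rw [hm₂c _ h21'.symm (hcc h21.symm), hm₁b, hmfix _ h10 h10']
      · rw [hinvM, hm₂c _ h21.symm (hsw' h21'), hm₁a, hmfix _ (hsw h10') (hcc h10)]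
      · rw [hm₂b, hm₁c _ h21 h21', hmfix _ h20 h20']
      · rw [hinvM, hm₂a, hm₁c _ (hsw h21') (hcc h21), hmfix _ (hsw h20') (hcc h20)]
    -- … hence every embedding of `K`: but there it is complex conjugation
    have := htr hall s₀
    rw [mul_smul, mul_smul, mul_smul, one_smul, conj_smul_eq_conjugate, hm₂K, hm₁K, hmK] at this
    exact conjugate_ne s₀ this
  · -- case B: no pair is stable; `τ` is a `3`-cycle on pairs and `τ⁶` fixes `Hom(M, ℂ)`
    push Not at hC
    have hB3 : ∀ t : M →+* ℂ, τ • τ • τ • t = t ∨ τ • τ • τ • t = conjugate t := by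
      intro t
      obtain ⟨hta, hta'⟩ := hC t
      obtain ⟨htb, htb'⟩ := hC (τ • t)
      have hne1 : τ • t ≠ t := hta
      have hne1' : τ • t ≠ conjugate t := hta'
      -- `τ² t ∉ {t, t̄}`: otherwise `τ` swaps the pairs of `t` and `τ t` and fixes the third pair
      have hne2 : τ • τ • t ≠ t ∧ τ • τ • t ≠ conjugate t := by
        by_contra hcon
        rw [not_and_or, not_not, not_not] at hcon
        -- an embedding outside the pairs of `t` and `τ t`
        have hlt : ({t, conjugate t, τ • t, conjugate (τ • t)} : Finset (M →+* ℂ)).card <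
            (Finset.univ : Finset (M →+* ℂ)).card :=
          lt_of_le_of_lt (Finset.card_le_four) (by rw [Finset.card_univ, Embeddings.card, h6]; norm_num)
        obtain ⟨t', -, ht'⟩ := Finset.exists_mem_notMem_of_card_lt_card hlt
        simp only [Finset.mem_insert, Finset.mem_singleton, not_or] at ht'
        obtain ⟨h1, h2, h3, h4⟩ := ht'
        -- `τ t'` avoids the two pairs
        have k1 : τ • t' ≠ τ • t := fun h => h1 ((smul_left_cancel_iff τ).1 h)
        have k2 : τ • t' ≠ conjugate (τ • t) := fun h => h2 ((smul_left_cancel_iff τ).1 (by rw [h, smul_conjugate]))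
        have k3 : τ • t' ≠ t ∧ τ • t' ≠ conjugate t := by
          rcases hcon with h | h
          · refine ⟨fun e => h3 ((smul_left_cancel_iff τ).1 (e.trans h.symm)), fun e => h4 ?_⟩
            exact (smul_left_cancel_iff τ).1 (e.trans (by rw [smul_conjugate, h]))
          · refine ⟨fun e => h4 ((smul_left_cancel_iff τ).1 (e.trans (by rw [smul_conjugate, h, hinvM]))),
              fun e => h3 ((smul_left_cancel_iff τ).1 (e.trans h.symm))⟩
        rcases eq_or_of_six h6 hne1 hne1' h1 h2 h3 h4 (τ • t') with h | h | h | h | h | h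
        · exact k3.1 h
        · exact k3.2 h
        · exact k1 h
        · exact k2 h
        · exact (hC t').1 h
        · exact (hC t').2 h
      rcases eq_or_of_six h6 hne1 hne1' hne2.1 hne2.2 htb htb' (τ • τ • τ • t) with h | h | h | h | h | h
      · exact Or.inl h
      · exact Or.inr h
      · exact (hne2.1 ((smul_left_cancel_iff τ).1 h)).elim
      · exact (hne2.2 ((smul_left_cancel_iff τ).1 (by rw [h, smul_conjugate]))).elim
      · exact ((hC (τ • τ • t)).1 h).elim
      · exact ((hC (τ • τ • t)).2 h).elim
    have h6fix : ∀ t : M →+* ℂ, (τ * τ * τ * (τ * τ * τ)) • t = (1 : ℂ ≃+* ℂ) • t := by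
      intro t
      rw [one_smul, mul_smul, mul_smul, mul_smul, mul_smul, mul_smul]
      rcases hB3 t with h | h
      · rw [h, h]
      · rw [h, smul_conjugate, smul_conjugate, smul_conjugate, h, hinvM]
    have := htr h6fix s₀
    rw [one_smul, mul_smul, mul_smul, mul_smul, mul_smul, mul_smul, hτ, hK4] at this
    exact conjugate_ne s₀ this

/-- **The Galois closure of a sextic CM field contains no quartic CM field which is not biquadratic** (cyclic Galois
or non-Galois: both carry a square root of complex conjugation in `Aut(ℂ)`, seat p2).
[cite: Dodson1984, §1] [cite: Shimura1998, §8.4 Example (2)] -/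
theorem not_normalClosure_le_of_quartic_of_sextic (h4 : finrank ℚ K = 4)
    (hK : ¬ (IsGalois ℚ K ∧ ¬ IsCyclic (K ≃ₐ[ℚ] K))) (h6 : finrank ℚ M = 6) :
    ¬ normalClosure ℚ K ℂ ≤ normalClosure ℚ M ℂ := by
  by_cases hG : IsGalois ℚ K
  · haveI := hG
    haveI : IsCyclic (K ≃ₐ[ℚ] K) := by
      by_contra h
      exact hK ⟨hG, h⟩
    obtain ⟨τ, hτ⟩ := ConjSquare.exists_ringAut_smul_smul_eq_conjugate_of_isCyclic (K := K) (by rw [h4])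
    exact not_normalClosure_le_of_smul_smul_eq_conjugate_of_finrank_eq_six h6 hτ
  · obtain ⟨τ, hτ⟩ := QuarticCM.exists_ringAut_smul_smul_eq_conjugate h4 hG
    exact not_normalClosure_le_of_smul_smul_eq_conjugate_of_finrank_eq_six h6 hτ

end Fields

/-! ## §2 Simple CM surfaces times CM threefolds -/

section Geometry

variable {I : Type} {K : I → Type} [∀ i, Field (K i)] [∀ i, NumberField (K i)] [∀ i, IsCMField (K i)] [Fintype I]
  [Nonempty I] {Φ : ∀ i, CMType (K i)}
variable {A : I → AbelianVariety ℂ} {ι : ∀ i, 𝓞 (K i) →+* End (A i)}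
  {θ : ∀ i, K i →+* Module.End ℂ (complexBetti (A i).X 1)}

/-- **A quartic CM field (not biquadratic) and ANY sextic CM field: for all types, the pair is nondegenerate iff the
sextic type is** (`rank Hg(S × T) = 2 + rank Hg(T)`: Moonen–Zarhin (0.2) (4) «`Hg(X) = Hg(Y₁) × Hg(Y₂)`», CM case,
surface × threefold). [cite: MoonenZarhin1999LowDim, Thm. (0.2) (4) and Cor. (3.9)] [cite: Gordon1999HodgeAVSurvey, 7.5] -/
theorem isNondegenerateFamily_surface_threefold_iff {i₀ i₁ : I} (h01 : i₀ ≠ i₁)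
    (hI : ∀ j, j = i₀ ∨ j = i₁) (h4 : finrank ℚ (K i₀) = 4)
    (hK₀ : ¬ (IsGalois ℚ (K i₀) ∧ ¬ IsCyclic (K i₀ ≃ₐ[ℚ] K i₀))) (h6 : finrank ℚ (K i₁) = 6) :
    CMAlgebra.IsNondegenerateFamily Φ ↔ IsNondegenerate (Φ i₁) :=
  isNondegenerateFamily_iff_surface_times_of_not_le h01 hI h4 hK₀
    (not_normalClosure_le_of_quartic_of_sextic h4 hK₀ h6)

/-- **A quartic CM field (not biquadratic) and a PRIMITIVE sextic type: the pair is nondegenerate** (primitive sextic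
types are nondegenerate, Ribet's bound in degree `≤ 6`). [cite: MoonenZarhin1999LowDim, Thm. (0.2) (4)]
[cite: Ribet1980, §3 (3.7)] -/
theorem isNondegenerateFamily_surface_threefold_of_isPrimitive {i₀ i₁ : I} (h01 : i₀ ≠ i₁)
    (hI : ∀ j, j = i₀ ∨ j = i₁) (h4 : finrank ℚ (K i₀) = 4)
    (hK₀ : ¬ (IsGalois ℚ (K i₀) ∧ ¬ IsCyclic (K i₀ ≃ₐ[ℚ] K i₀))) (h6 : finrank ℚ (K i₁) = 6) {φ₁ : K i₁ →+* ℂ}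
    (hprim : IsPrimitive (ℂ ≃+* ℂ) (Φ i₁).1 φ₁) : CMAlgebra.IsNondegenerateFamily Φ :=
  (isNondegenerateFamily_surface_threefold_iff h01 hI h4 hK₀ h6).2
    (isNondegenerate_of_isPrimitive_of_finrank_le_six (Φ i₁) (by omega) φ₁ hprim)

/-- **A CM abelian surface with a non-biquadratic quartic field times a realisation of a NONDEGENERATE sextic CM type:
the Hodge conjecture and `B• = D•` on every `S^a × T^b`** (every `⨁_{j<N} A_{π j}`), UNCONDITIONALLY.
[cite: MoonenZarhin1999LowDim, Thm. (0.2) (4)] [cite: Gordon1999HodgeAVSurvey, 7.5 and 10.10] -/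
theorem hodgeConjectureFor_prod_surface_threefold {i₀ i₁ : I} (h01 : i₀ ≠ i₁) (hI : ∀ j, j = i₀ ∨ j = i₁)
    (h4 : finrank ℚ (K i₀) = 4) (hK₀ : ¬ (IsGalois ℚ (K i₀) ∧ ¬ IsCyclic (K i₀ ≃ₐ[ℚ] K i₀)))
    (h6 : finrank ℚ (K i₁) = 6) (hΦ₁ : IsNondegenerate (Φ i₁))
    (hA : ∀ i, IsCMTypeRealisation (Φ i) (A i) (ι i) (θ i)) {N : ℕ} (π : Fin N → I) :
    HodgeConjectureFor (⨁ fun j : Fin N => A (π j)).dim (⨁ fun j : Fin N => A (π j)).X ∧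
      ∀ m : ℕ, hodgeClassSpan (⨁ fun j : Fin N => A (π j)).dim (⨁ fun j : Fin N => A (π j)).X m =
        divisorClassesSpan (⨁ fun j : Fin N => A (π j)).X (⨁ fun j : Fin N => A (π j)).dim m :=
  hodgeConjectureFor_prod_surface_times_of_not_le h01 hI h4 hK₀ (not_normalClosure_le_of_quartic_of_sextic h4 hK₀ h6)
    hΦ₁ hA π

/-- **MAIN COROLLARY — a SIMPLE CM abelian surface `S` times a SIMPLE CM abelian threefold `T` (any quartic and sextic
CM fields, any types): the Hodge conjecture and `B• = D•` on every `S^a × T^b`** (every `⨁_{j<N} A_{π j}` of the two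
realisations), UNCONDITIONALLY — Moonen–Zarhin (0.2) (4) for `X ∼ S × T`, CM case: simple ⟹ primitive types
(Shimura Prop. 26) ⟹ `K_S` not biquadratic and `Φ_T` nondegenerate (Ribet).  New for NON-Galois sextic `K_T`
(`[L_T : ℚ] ∈ {12, 24, 48}`, a multiple of `[L_S : ℚ] ∈ {4, 8}` in several cases).
[cite: MoonenZarhin1999LowDim, Thm. (0.2) (4)] [cite: Gordon1999HodgeAVSurvey, 7.5 and 10.10]
[cite: Shimura1998, §8.2 Prop. 26] -/
theorem hodgeConjectureFor_prod_simpleSurface_simpleThreefold {i₀ i₁ : I} (h01 : i₀ ≠ i₁)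
    (hI : ∀ j, j = i₀ ∨ j = i₁) (h4 : finrank ℚ (K i₀) = 4) (h6 : finrank ℚ (K i₁) = 6)
    (hA : ∀ i, IsCMTypeRealisation (Φ i) (A i) (ι i) (θ i)) (hS : (A i₀).IsSimple) (hT : (A i₁).IsSimple)
    {N : ℕ} (π : Fin N → I) :
    HodgeConjectureFor (⨁ fun j : Fin N => A (π j)).dim (⨁ fun j : Fin N => A (π j)).X ∧
      ∀ m : ℕ, hodgeClassSpan (⨁ fun j : Fin N => A (π j)).dim (⨁ fun j : Fin N => A (π j)).X m =
        divisorClassesSpan (⨁ fun j : Fin N => A (π j)).X (⨁ fun j : Fin N => A (π j)).dim m := by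
  obtain ⟨φ₁⟩ : Nonempty (K i₁ →+* ℂ) := inferInstance
  exact hodgeConjectureFor_prod_surface_threefold h01 hI h4
    (not_biquadratic_of_isPrimitive i₀ h4 ((isSimple_iff_isPrimitive (hA i₀) (Classical.arbitrary _)).1 hS)) h6
    (isNondegenerate_of_isPrimitive_of_finrank_le_six (Φ i₁) (by omega) φ₁
      ((isSimple_iff_isPrimitive (hA i₁) φ₁).1 hT)) hA π

/-- **Two simple CM abelian varieties of dimensions `2` and `3` form a NONDEGENERATE pair** (`rank Hg(S × T) = 5`): no
product `S^a × T^b` supports an exotic Hodge class. [cite: MoonenZarhin1999LowDim, Thm. (0.2) (4)]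
[cite: Gordon1999HodgeAVSurvey, 7.5–7.6] -/
theorem isNondegenerateFamily_simpleSurface_simpleThreefold {i₀ i₁ : I} (h01 : i₀ ≠ i₁)
    (hI : ∀ j, j = i₀ ∨ j = i₁) (h4 : finrank ℚ (K i₀) = 4) (h6 : finrank ℚ (K i₁) = 6)
    (hA : ∀ i, IsCMTypeRealisation (Φ i) (A i) (ι i) (θ i)) (hS : (A i₀).IsSimple) (hT : (A i₁).IsSimple) :
    CMAlgebra.IsNondegenerateFamily Φ := by
  obtain ⟨φ₁⟩ : Nonempty (K i₁ →+* ℂ) := inferInstance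
  exact isNondegenerateFamily_surface_threefold_of_isPrimitive h01 hI h4
    (not_biquadratic_of_isPrimitive i₀ h4 ((isSimple_iff_isPrimitive (hA i₀) (Classical.arbitrary _)).1 hS)) h6
    ((isSimple_iff_isPrimitive (hA i₁) φ₁).1 hT)

/-- **No `S^a × T^b` of a simple CM abelian surface and a simple CM abelian threefold supports an exotic Hodge class.**
[cite: MoonenZarhin1999LowDim, Thm. (0.2) (4)] [cite: Gordon1999HodgeAVSurvey, 7.5–7.6] -/
theorem not_exists_exceptional_prod_simpleSurface_simpleThreefold {i₀ i₁ : I} (h01 : i₀ ≠ i₁)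
    (hI : ∀ j, j = i₀ ∨ j = i₁) (h4 : finrank ℚ (K i₀) = 4) (h6 : finrank ℚ (K i₁) = 6)
    (hA : ∀ i, IsCMTypeRealisation (Φ i) (A i) (ι i) (θ i)) (hS : (A i₀).IsSimple) (hT : (A i₁).IsSimple)
    {N : ℕ} (π : Fin N → I) (m : ℕ) :
    ¬∃ c : complexBetti (⨁ fun j : Fin N => A (π j)).X (2 * m), IsRationalClass c ∧
        IsOfHodgeType (⨁ fun j : Fin N => A (π j)).dim (⨁ fun j : Fin N => A (π j)).X (2 * m) m m c ∧
        c ∉ divisorClassesSpan (⨁ fun j : Fin N => A (π j)).X (⨁ fun j : Fin N => A (π j)).dim m :=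
  (isNondegenerateFamily_simpleSurface_simpleThreefold h01 hI h4 h6 hA hS hT).not_exists_exceptional_prod hA π m

end Geometry

end Summit.HodgeConjecture.CorCM

end
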